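import Summits.Ventures.Crystal3D.Theorems.StickyWulffConstantNoReconstructionGainExactFilmAboveCut
import Summits.Ventures.Crystal3D.Theorems.StickyWulffConstantNoReconstructionGainExactCriminalBuried
import Summits.Ventures.Crystal3D.Theorems.StickyWulffConstantNoReconstructionGainThirdLatticeCoverB
import HarnessLib

/-!
# Film balls lie strictly ABOVE the cut, III: every normal (line `replication-exactness`)

HONEST FRAMING. Part of the venture `Summits/Ventures/Crystal3D` (cell `crystal3d-full`), supports the
crux `NoReconstructionGain` (stmt-Ventures-19144, route `route-Ventures-StickyWulffConstant`), line
`replication-exactness` (lead wulff-p1 g18).  Part II (`…ExactFilmAboveCut`) proved, for normals in the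
basal double cone `ν₃² ≥ 1/3` of the tree frame, that the lower open unit half-ball of every point
contains a site of `Λ₀ = fccStacking 1 √(2/3)`.  Here the cone restriction is removed with the lattice
isometries of `…ThirdLatticeCoverB` (`exists_latticeIso_perm`: every permutation of the four `{111}`
families is realised by an isometry of `Λ₀`):

* `sum_sq_inner_familyVec` — the four family vectors `N_h` (length `√(2/3)`, summing to zero) form a
  tight frame: `Σ_h ⟪ν, N_h⟫² = (8/9)‖ν‖²`; hence some family has `⟪ν, N_h⟫² ≥ 2/9`, i.e. makes an
  angle `≤ 54.7°` with `±ν`;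
* `exists_fcc_below_near` — **for EVERY unit `ν` and every point `x` there is a site `p ∈ Λ₀` with
  `⟪p, ν⟫ ≤ ⟪x, ν⟫` and `dist x p < 1`** (move the best family to the stacking axis, apply part II,
  move back);
* `IsFilmOn.lt_inner` — **every ball of every film on every rigid half-crystal face `H(ν,s)` lies
  strictly above the cut: `s < ⟪q, ν⟫`**; `plug_below` — every plug is strictly `ν`-below its film
  ball.  Consequences recorded for the criminal anatomy: the `ν`-height orientation never sees an
  "overhang plug", so `slack(Q) = Σ_q (6 − #lower film partners − #plugs)` exactly, the top ball of a
  film has all its partners in a closed lower half-space (`≤ 9` of them), and the hypotheses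
  `s ≤ ⟪q,ν⟫` in `exists_cup_window_of_criminal` / `exists_buried_offLattice_of_criminal` always hold
  (`exists_cup_window_of_criminal'`, `exists_buried_offLattice_of_criminal'` below); and
  `exists_top_window_of_criminal` — the `ν`-highest ball of a criminal has between `7` and `9`
  partners, all in the closed lower half-space.

WHAT THIS IS NOT: anything about the crux itself; rung F-C1 not moved.
-/

noncomputable section

namespace Summit.Ventures.Crystal3D.Theorems

open Summit.Ventures.Crystal3D
open Literature.MathematicalPhysics.StatisticalMechanics (fccStacking barlowPos constHagg haggLabel_const
  barlowPos_apply_zero barlowPos_apply_one barlowPos_apply_two)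
open scoped InnerProductSpace
open Finset

/-- **Tight frame of the four family vectors**: `Σ_h ⟪ν, N_h⟫² = (8/9)‖ν‖²` for
`N₀ = ⅓(3,−1,−1)`, `N₁ = ⅓(−1,−1,3)`, `N₂ = ⅓(−1,3,−1)`, `N₃ = ⅓(−1,−1,−1)` (in `barlowPos`
coordinates `(k,i,j)`). -/
theorem sum_sq_inner_familyVec (ν : EuclideanSpace ℝ (Fin 3)) :
    ⟪ν, (1 / 3 : ℝ) • barlowPos 1 (Real.sqrt (2 / 3)) constHagg 3 (-1) (-1)⟫_ℝ ^ 2 +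
      ⟪ν, (1 / 3 : ℝ) • barlowPos 1 (Real.sqrt (2 / 3)) constHagg (-1) (-1) 3⟫_ℝ ^ 2 +
      ⟪ν, (1 / 3 : ℝ) • barlowPos 1 (Real.sqrt (2 / 3)) constHagg (-1) 3 (-1)⟫_ℝ ^ 2 +
      ⟪ν, (1 / 3 : ℝ) • barlowPos 1 (Real.sqrt (2 / 3)) constHagg (-1) (-1) (-1)⟫_ℝ ^ 2 =
      8 / 9 * ‖ν‖ ^ 2 := by
  have hinner : ∀ a b : EuclideanSpace ℝ (Fin 3), ⟪a, b⟫_ℝ = a 0 * b 0 + a 1 * b 1 + a 2 * b 2 := by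
    intro a b; simp [PiLp.inner_apply, Fin.sum_univ_three, mul_comm]
  have h3 : Real.sqrt 3 ^ 2 = 3 := Real.sq_sqrt (by norm_num)
  have hh2 : Real.sqrt (2 / 3) ^ 2 = 2 / 3 := Real.sq_sqrt (by norm_num)
  have hc : ∀ k i j : ℤ, ⟪ν, (1 / 3 : ℝ) • barlowPos 1 (Real.sqrt (2 / 3)) constHagg k i j⟫_ℝ =
      1 / 3 * (ν 0 * ((i : ℝ) + (j : ℝ) / 2 + (k : ℝ) / 2) +
        ν 1 * (Real.sqrt 3 / 2 * ((j : ℝ) + (k : ℝ) / 3)) + ν 2 * ((k : ℝ) * Real.sqrt (2 / 3))) := by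
    intro k i j
    rw [inner_smul_right, hinner, barlowPos_apply_zero, barlowPos_apply_one, barlowPos_apply_two,
      haggLabel_const]
    ring
  have hn : ‖ν‖ ^ 2 = ν 0 ^ 2 + ν 1 ^ 2 + ν 2 ^ 2 := by
    rw [EuclideanSpace.real_norm_sq_eq, Fin.sum_univ_three]
  rw [hc, hc, hc, hc, hn]
  push_cast
  ring_nf
  rw [h3, hh2]
  ring

/-- **The lower open unit half-ball of every point contains a lattice site — every normal.**  For every
unit `ν` and every `x` there is `p ∈ Λ₀` with `⟪p, ν⟫ ≤ ⟪x, ν⟫` and `dist x p < 1`. -/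
theorem exists_fcc_below_near {ν : EuclideanSpace ℝ (Fin 3)} (hν : ‖ν‖ = 1)
    (x : EuclideanSpace ℝ (Fin 3)) :
    ∃ p ∈ fccStacking 1 (Real.sqrt (2 / 3)), ⟪p, ν⟫_ℝ ≤ ⟪x, ν⟫_ℝ ∧ dist x p < 1 := by
  -- the four family vectors and the best one
  set F : Fin 4 → EuclideanSpace ℝ (Fin 3) := ![((1 / 3 : ℝ) • barlowPos 1 (Real.sqrt (2 / 3)) constHagg 3 (-1) (-1)), ((1 / 3 : ℝ) • barlowPos 1 (Real.sqrt (2 / 3)) constHagg (-1) (-1) 3), ((1 / 3 : ℝ) • barlowPos 1 (Real.sqrt (2 / 3)) constHagg (-1) 3 (-1)), ((1 / 3 : ℝ) • barlowPos 1 (Real.sqrt (2 / 3)) constHagg (-1) (-1) (-1))] with hF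
  have hsum := sum_sq_inner_familyVec ν
  rw [hν] at hsum
  have hbest : ∃ h : Fin 4, 2 / 9 ≤ ⟪ν, F h⟫_ℝ ^ 2 := by
    by_contra hno
    push Not at hno
    have h0 := hno 0
    have h1 := hno 1
    have h2 := hno 2
    have h3 := hno 3
    simp only [hF, Matrix.cons_val_zero, Matrix.cons_val_one, Matrix.head_cons, Matrix.cons_val_two,
      Matrix.tail_cons, Matrix.cons_val_three] at h0 h1 h2 h3
    linarith
  obtain ⟨h, hh⟩ := hbest
  -- a lattice isometry moving family `h` to the stacking axis
  obtain ⟨g, hg, hg', hN⟩ := exists_latticeIso_perm (Equiv.swap h 0)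
  have hgF : g (F h) = F 0 := by
    have := hN h
    rw [Equiv.swap_apply_left] at this
    rw [hF]; exact this
  have hF0 : F 0 = (1 / 3 : ℝ) • barlowPos 1 (Real.sqrt (2 / 3)) constHagg 3 (-1) (-1) := by
    rw [hF]; rfl
  -- the moved normal lies in the basal cone
  have hν' : ‖g ν‖ = 1 := by rw [g.norm_map, hν]
  have hhpos : 0 < Real.sqrt (2 / 3) := Real.sqrt_pos.2 (by norm_num)
  have hh2 : Real.sqrt (2 / 3) ^ 2 = 2 / 3 := Real.sq_sqrt (by norm_num)
  have hcoord : ⟪g ν, F 0⟫_ℝ = (g ν) 2 * Real.sqrt (2 / 3) := by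
    have hinner : ∀ a b : EuclideanSpace ℝ (Fin 3), ⟪a, b⟫_ℝ = a 0 * b 0 + a 1 * b 1 + a 2 * b 2 := by
      intro a b; simp [PiLp.inner_apply, Fin.sum_univ_three, mul_comm]
    rw [hF0, inner_smul_right, hinner, barlowPos_apply_zero, barlowPos_apply_one, barlowPos_apply_two,
      haggLabel_const]
    push_cast
    ring
  have hcone : 1 / 3 ≤ (g ν) 2 ^ 2 := by
    have h1 : ⟪g ν, F 0⟫_ℝ = ⟪ν, F h⟫_ℝ := by rw [← hgF, LinearIsometryEquiv.inner_map_map]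
    have h2 : ((g ν) 2) ^ 2 * (2 / 3) = ⟪ν, F h⟫_ℝ ^ 2 := by
      rw [← h1, hcoord, mul_pow, hh2]
    nlinarith
  -- apply part II to the moved data and move back
  obtain ⟨p, hp, hle, hd⟩ := exists_fcc_below_near_of_cone hν' hcone (g x)
  refine ⟨g.symm p, hg' p hp, ?_, ?_⟩
  · have e1 : ⟪g.symm p, ν⟫_ℝ = ⟪p, g ν⟫_ℝ := by
      rw [← LinearIsometryEquiv.inner_map_map g (g.symm p) ν, LinearIsometryEquiv.apply_symm_apply]
    have e2 : ⟪x, ν⟫_ℝ = ⟪g x, g ν⟫_ℝ := (LinearIsometryEquiv.inner_map_map g x ν).symm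
    rw [e1, e2]; exact hle
  · have : dist x (g.symm p) = dist (g x) (g (g.symm p)) := (g.dist_map x (g.symm p)).symm
    rw [this, LinearIsometryEquiv.apply_symm_apply]; exact hd

/-! ## Films lie strictly above the cut — every face -/

/-- **Every ball of every film on every rigid half-crystal face lies strictly above the cut.** -/
theorem IsFilmOn.lt_inner {ν : EuclideanSpace ℝ (Fin 3)} (hν : ‖ν‖ = 1) {s : ℝ}
    {Q : Finset (EuclideanSpace ℝ (Fin 3))} (hQ : IsFilmOn ν s Q) {q : EuclideanSpace ℝ (Fin 3)}
    (hq : q ∈ Q) : s < ⟪q, ν⟫_ℝ := by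
  by_contra h
  push Not at h
  obtain ⟨p, hpΛ, hle, hd⟩ := exists_fcc_below_near hν q
  have h1 := hQ.2 q hq p ⟨hpΛ, hle.trans h⟩
  linarith

/-- **Plugs are strictly below their film ball** (every face). -/
theorem plug_below {ν : EuclideanSpace ℝ (Fin 3)} (hν : ‖ν‖ = 1) {s : ℝ}
    {Q : Finset (EuclideanSpace ℝ (Fin 3))} (hQ : IsFilmOn ν s Q) {q : EuclideanSpace ℝ (Fin 3)}
    (hq : q ∈ Q) {p : EuclideanSpace ℝ (Fin 3)} (hp : p ∈ plugSet ν s q) : ⟪p, ν⟫_ℝ < ⟪q, ν⟫_ℝ :=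
  lt_of_le_of_lt hp.1.2 (IsFilmOn.lt_inner hν hQ hq)

/-! ## Consequences for the criminal anatomy -/

open scoped Classical in
/-- **Cup window, unconditional**: every criminal has a cupped ball `q` (at least `7` among plugs and
`ν`-lower film partners) whose cup has at most `9` members, at least `2` of them shallow. -/
theorem exists_cup_window_of_criminal' {ν : EuclideanSpace ℝ (Fin 3)} (hν : ‖ν‖ = 1) {s : ℝ}
    {Q : Finset (EuclideanSpace ℝ (Fin 3))} (hQ : IsCriminal ν s Q) :
    ∃ q ∈ Q, 7 ≤ (plugSet ν s q).ncard +
      (Q.filter fun q' => dist q q' = 1 ∧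
        (⟪q', ν⟫_ℝ < ⟪q, ν⟫_ℝ ∨ (⟪q', ν⟫_ℝ = ⟪q, ν⟫_ℝ ∧ WellOrderingRel q' q))).card ∧
      (plugSet ν s q).ncard +
          (Q.filter fun q' => dist q q' = 1 ∧
            (⟪q', ν⟫_ℝ < ⟪q, ν⟫_ℝ ∨ (⟪q', ν⟫_ℝ = ⟪q, ν⟫_ℝ ∧ WellOrderingRel q' q))).card ≤ 9 ∧
      2 * ((plugSet ν s q).ncard +
          (Q.filter fun q' => dist q q' = 1 ∧
            (⟪q', ν⟫_ℝ < ⟪q, ν⟫_ℝ ∨ (⟪q', ν⟫_ℝ = ⟪q, ν⟫_ℝ ∧ WellOrderingRel q' q))).card) ≤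
        12 + ({p ∈ plugSet ν s q | ⟪q - p, ν⟫_ℝ ≤ 1 / 2}.ncard +
          (Q.filter fun q' => dist q q' = 1 ∧
            (⟪q', ν⟫_ℝ < ⟪q, ν⟫_ℝ ∨ (⟪q', ν⟫_ℝ = ⟪q, ν⟫_ℝ ∧ WellOrderingRel q' q)) ∧
            ⟪q - q', ν⟫_ℝ ≤ 1 / 2).card) := by
  obtain ⟨q, hq, h7, himp⟩ := exists_cup_window_of_criminal hν hQ
  obtain ⟨h9, hsh⟩ := himp (IsFilmOn.lt_inner hν hQ.1 hq).le
  exact ⟨q, hq, h7, h9, hsh⟩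

open scoped Classical in
/-- **Buried heavy ball, unconditional**: every criminal contains an off-lattice ball with at least ten
contacts, surrounded on every side, with a FILM partner strictly `ν`-above it. -/
theorem exists_buried_offLattice_of_criminal' {ν : EuclideanSpace ℝ (Fin 3)} (hν : ‖ν‖ = 1) {s : ℝ}
    {Q : Finset (EuclideanSpace ℝ (Fin 3))} (hQ : IsCriminal ν s Q) :
    ∃ q ∈ Q, q ∉ fccStacking 1 (Real.sqrt (2 / 3)) ∧
      10 ≤ (plugSet ν s q).ncard + (Q.filter fun y => dist q y = 1).card ∧
      (∀ e : EuclideanSpace ℝ (Fin 3), ‖e‖ = 1 →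
        ∃ x, (x ∈ plugSet ν s q ∨ (x ∈ Q ∧ dist q x = 1)) ∧ ⟪e, x - q⟫_ℝ < 0) ∧
      ∃ y ∈ Q, dist q y = 1 ∧ ⟪q, ν⟫_ℝ < ⟪y, ν⟫_ℝ := by
  obtain ⟨q, hq, hqΛ, h10, hsur, hup⟩ := exists_buried_offLattice_of_criminal hν hQ
  exact ⟨q, hq, hqΛ, h10, hsur, hup (IsFilmOn.lt_inner hν hQ.1 hq).le⟩

open scoped Classical in
/-- **The top ball of a criminal**: the `ν`-highest ball has all its partners (plugs and film balls) in
the closed lower half-space, hence between `7` and `9` of them (`B(3) = 9`). -/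
theorem exists_top_window_of_criminal {ν : EuclideanSpace ℝ (Fin 3)} (hν : ‖ν‖ = 1) {s : ℝ}
    {Q : Finset (EuclideanSpace ℝ (Fin 3))} (hQ : IsCriminal ν s Q) :
    ∃ q ∈ Q, (∀ y ∈ Q, ⟪y, ν⟫_ℝ ≤ ⟪q, ν⟫_ℝ) ∧
      7 ≤ (plugSet ν s q).ncard + (Q.filter fun y => dist q y = 1).card ∧
      (plugSet ν s q).ncard + (Q.filter fun y => dist q y = 1).card ≤ 9 := by
  obtain ⟨q, hq, hmax⟩ := Finset.exists_max_image Q (fun y => ⟪y, ν⟫_ℝ) hQ.2.1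
  refine ⟨q, hq, hmax, seven_le_plug_add_deg_of_criminal hQ hq, ?_⟩
  have hfin := plugSet_finite ν s q
  set T := hfin.toFinset ∪ Q.filter fun y => dist q y = 1 with hTdef
  have hdisj : Disjoint hfin.toFinset (Q.filter fun y => dist q y = 1) := by
    rw [Finset.disjoint_left]
    intro y hy hy'
    rw [Set.Finite.mem_toFinset] at hy
    rw [Finset.mem_filter] at hy'
    have := hQ.1.2 y hy'.1 y hy.1
    rw [dist_self] at this; linarith
  have hTcard : T.card = (plugSet ν s q).ncard + (Q.filter fun y => dist q y = 1).card := by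
    rw [hTdef, Finset.card_union_of_disjoint hdisj, Set.ncard_eq_toFinset_card _ hfin]
  have hT : ∀ x ∈ T, (x ∈ plugSet ν s q ∨ x ∈ Q) ∧ dist q x = 1 := by
    intro x hx
    rw [hTdef, Finset.mem_union, Set.Finite.mem_toFinset, Finset.mem_filter] at hx
    rcases hx with hx | hx
    · exact ⟨Or.inl hx, hx.2⟩
    · exact ⟨Or.inr hx.1, hx.2⟩
  have hne : ‖-ν‖ = 1 := by rw [norm_neg, hν]
  have hhalf : ∀ x ∈ T, 0 ≤ ⟪-ν, x - q⟫_ℝ := by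
    intro x hx
    rw [inner_neg_left, inner_sub_right, real_inner_comm q ν, real_inner_comm x ν]
    rw [hTdef, Finset.mem_union, Set.Finite.mem_toFinset, Finset.mem_filter] at hx
    rcases hx with hx | hx
    · have := plug_below hν hQ.1 hq hx
      linarith
    · have := hmax x hx.1
      linarith
  rw [← hTcard]
  exact card_halfspace_partners_le_nine hQ.1 q hne T hT hhalf

end Summit.Ventures.Crystal3D.Theorems

end
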